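import Summits.QuantumFields.QCD.Theorems.WilsonMobilityGapMobilityGapPositiveMassDecay
import Summits.QuantumFields.QCD.Theorems.MobilityGap.Negative.LowerPin

/-!
# The lattice-LIGHT junk witness: clauses (i), (ii), (iv) of `MobilityGap` and both scalings are
# inhabited along positive bare masses of order `a_k` — the crux's content is clause (iii) at `n ≥ 1`
# (crux stmt-QuantumFields-9150, line `Sketch`; lead c5, 2026-08-16)

The standing disproof (`Negative/LowerPin.lean`, cdisprove c1) showed that the crux minus clause
(iii) is inhabited by the lattice-HEAVY witness `heavyReg` (`m_crit ≡ 1`, decay at a LATTICE rate by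
the hopping expansion), and that (iii) forces `|m_f(k) + 4| < 41/10` and `m_crit(k) ≤ K a_k`
(`…CriticalMassOrder`).  One could still hope that clause (ii) carries content once the trajectory is
lattice-light, because every tool of the tree (hopping / Neumann series, accretive Combes–Thomas) has an
amplitude `≍ 1/m` that is not `k`-uniform at `m ≍ a_k`.  It does not: by the deterministic bound of
`…PositiveMassDecay` (pointwise coercivity from Wilson positivity + Kato + four-torus Sobolev + the
`d = 4` Green constant, fed into a pointwise-coercive Combes–Thomas argument),

* `upper_of_eventually_pos_light` — clause (ii) UPPER holds for EVERY regularisation and mass tuple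
  whose realised bare masses satisfy `c a_k ≤ m_f(k) ≤ 1` eventually, at the physical-form rate
  `δ a_k` with a `k`-uniform constant, DETERMINISTICALLY (no property of the Wilson measure is used);
* `clauseI_of_eventually_pos`, `sign_of_eventually_pos` — (i) and (iv) are free at positive bare
  masses (Seiler positivity, landed `signRatio_eq_one_of_pos`);
* `exists_light_witness_without_lower` — hence for `N_f ∈ {2,3}` the regularisation
  `canonicalAF` with `m_crit(k) := a_k` (bare masses in `[a_k, 2a_k]` eventually: lattice-LIGHT,
  `κ → 1/8⁻`) carries both scalings and clauses (i), (ii), (iv) for every positive mass tuple;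
* `mobilityGap_of_posLower` — consequently `MobilityGap` follows from clause (iii) ALONE along any
  admissible trajectory of positive bare masses `m_crit(k) ∈ [c a_k, 1/2]` (`PosLower`).

PHYSICS CAVEAT (why the last item is a map of the content, not a line).  `PosLower` is expected to be
FALSE: at weak coupling the additive mass renormalisation of Wilson fermions is negative,
`m_c(β) ≈ −0.87/β < 0` (one loop; non-perturbatively `κ_c(β_W = 6.0) ≈ 0.157`), so a quark with bare
mass `+a_k` has lattice mass `≈ |m_c(β_k)| ≍ 1/β_k ≍ 1/|log a_k| ≫ a_k` and its propagator decays at a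
rate that violates the `O(a_k)` floor of clause (iii).  Neither this violation nor the honest (iii) at
`m_crit(k) ≈ m_c(β_k) < 0` is provable with present tools: both are the non-perturbative control of mass
renormalisation at weak coupling.  What IS proved here is that clauses (i), (ii), (iv) and the scalings,
AS TYPED, do not distinguish the honest trajectory from the junk one even at lattice-light masses and
physical-form rates; the entire content of `MobilityGap` is clause (iii) at separations `n ≥ 1`
(at `n = 0` a deterministic lower bound holds at positive mass), in the supercritical window.
Pure theorem file (no definitions).
-/

noncomputable section

namespace Summit.QuantumFields.QCD.Theorems.MobilityGapPositiveMass

open scoped BigOperators Topology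
open MeasureTheory Filter Set
open Literature.MathematicalPhysics.QuantumFieldTheory Literature.MathematicalPhysics.QuantumLattice
  Literature.Probability.LatticeModels
open Summit.QuantumFields.QCD.Theorems.MobilityGapNegative

variable {Nf : ℕ}

/-! ### Clauses (i), (ii), (iv) along positive, lattice-light bare masses -/

/-- **Clause (ii) UPPER is deterministic along positive lattice-light trajectories.**  If the realised
bare masses of `(reg, m)` satisfy `c a_k ≤ m_f(k) ≤ 1` eventually (`c > 0`), then clause (ii) holds —
with `s = 1/2`, physical rate `δ = c₀ c / 2` and a `k`-uniform constant — for EVERY coupling sequence: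
no property of the Wilson measure is used (`fm_le_of_pos_mass` integrated; the volume condition
`m_f(k) (2S+1)⁴ ≥ 1` for `S ≥ L_k` follows from `a_k L_k → ∞`). [folklore] -/
theorem upper_of_eventually_pos_light (reg : QCDRegularisation Nf) (m : Fin Nf → ℝ)
    (hpos : ∃ c : ℝ, 0 < c ∧ ∀ᶠ k in atTop, ∀ f, c * reg.a k ≤ bare reg m k f ∧ bare reg m k f ≤ 1) :
    Upper reg m := by
  obtain ⟨C, c₀, hC, hc₀, hbound⟩ := fm_le_of_pos_mass
  obtain ⟨c, hc, hk⟩ := hpos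
  refine ⟨1 / 2, c₀ * c / 2, C, by norm_num, by norm_num, by positivity, ?_⟩
  -- the volume condition, eventually
  have hvol : ∀ᶠ k in atTop, 1 ≤ c * (reg.a k * reg.L k) :=
    (reg.tendsto_L.eventually_ge_atTop (1 / c)).mono fun k hk => by
      rwa [div_le_iff₀' hc] at hk
  filter_upwards [hk, hvol] with k hk hvk S hS f v hv
  have hb := hk f
  have ha := reg.a_pos k
  -- `1 ≤ m_f(k) (2S+1)⁴`
  have hS1 : (reg.L k : ℝ) ≤ ((2 * S + 1 : ℕ) : ℝ) ^ 4 := by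
    have h1 : (reg.L k : ℝ) ≤ ((2 * S + 1 : ℕ) : ℝ) := by exact_mod_cast (by omega : reg.L k ≤ 2 * S + 1)
    have h2 : (1 : ℝ) ≤ ((2 * S + 1 : ℕ) : ℝ) := by exact_mod_cast (by omega : 1 ≤ 2 * S + 1)
    calc (reg.L k : ℝ) ≤ ((2 * S + 1 : ℕ) : ℝ) := h1
      _ = ((2 * S + 1 : ℕ) : ℝ) ^ 1 := (pow_one _).symm
      _ ≤ ((2 * S + 1 : ℕ) : ℝ) ^ 4 := pow_le_pow_right₀ h2 (by norm_num)
  have hvolS : 1 ≤ bare reg m k f * ((2 * S + 1 : ℕ) : ℝ) ^ 4 := by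
    calc (1 : ℝ) ≤ c * (reg.a k * reg.L k) := hvk
      _ = (c * reg.a k) * reg.L k := by ring
      _ ≤ bare reg m k f * ((2 * S + 1 : ℕ) : ℝ) ^ 4 :=
          mul_le_mul hb.1 hS1 (Nat.cast_nonneg _) (by linarith [mul_pos hc ha])
  have h0 : 0 < bare reg m k f := lt_of_lt_of_le (mul_pos hc ha) hb.1
  have h := hbound Nf (reg.β k) (bare reg m k) f h0 hb.2 S hvolS (1 / 2) (by norm_num) (by norm_num) v hv
  unfold fm
  refine h.trans (mul_le_mul_of_nonneg_left (Real.exp_le_exp.2 ?_) hC.le)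
  -- `c₀ c/2 · a_k ‖v‖ ≤ c₀ · m_f(k) · ½ · ‖v‖`
  have hv0 : 0 ≤ ‖v‖ := norm_nonneg _
  have : c₀ * c / 2 * (reg.a k * ‖v‖) ≤ c₀ * bare reg m k f * (1 / 2) * ‖v‖ := by
    have h1 : c * reg.a k * ‖v‖ ≤ bare reg m k f * ‖v‖ := mul_le_mul_of_nonneg_right hb.1 hv0
    nlinarith [h1, hc₀.le]
  linarith

/-- **Clause (i) is free at positive bare masses.** [folklore] -/
theorem clauseI_of_eventually_pos (reg : QCDRegularisation Nf) (m : Fin Nf → ℝ)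
    (hpos : ∀ᶠ k in atTop, ∀ f, 0 < bare reg m k f) : ClauseI reg m :=
  fun f => hpos.mono fun k hk => by have := hk f; simp only [bare] at this; linarith

/-- **Clause (iv) is free at positive bare masses** (Seiler positivity: the signed and the
phase-quenched partition functions coincide, ratio `= 1`). [folklore] -/
theorem sign_of_eventually_pos (reg : QCDRegularisation Nf) (m : Fin Nf → ℝ)
    (hpos : ∀ᶠ k in atTop, ∀ f, 0 < bare reg m k f) : Sign reg m :=
  hpos.mono fun k hk => by
    rw [signRatio_eq_one_of_pos (reg.β k) (bare reg m k) hk]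
    norm_num

/-! ### Scaling bookkeeping -/

/-- `log a_k⁻² → ∞` along any regularisation. [folklore] -/
theorem tendsto_log_inv_sq (reg : QCDRegularisation Nf) :
    Tendsto (fun k => Real.log (1 / reg.a k ^ 2)) atTop atTop := by
  have h0 : Tendsto (fun k => reg.a k ^ 2) atTop (𝓝[>] 0) := by
    refine tendsto_nhdsWithin_iff.2 ⟨?_, Eventually.of_forall fun k => pow_pos (reg.a_pos k) 2⟩
    simpa using reg.tendsto_a.pow 2
  have h1 : Tendsto (fun k => (reg.a k ^ 2)⁻¹) atTop atTop := h0.inv_tendsto_nhdsGT_zero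
  refine Real.tendsto_log_atTop.comp (h1.congr fun k => ?_)
  rw [one_div]

/-- **Mass scaling with a non-negative leading-log exponent keeps `a_k M / Z_m(k)` small**: under
`HasMassScaling` and `0 ≤ γ₀/(2β₀)` (i.e. `N_f ≤ 16`), for every `M` and `ε > 0`, eventually
`a_k M / Z_m(k) ≤ ε`. [folklore] -/
theorem eventually_a_mul_div_Zm_le (reg : QCDRegularisation Nf) (hms : reg.HasMassScaling)
    (hγ : 0 ≤ massExponent Nf) (M ε : ℝ) (hε : 0 < ε) :
    ∀ᶠ k in atTop, reg.a k * M / reg.Zm k ≤ ε := by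
  obtain ⟨c, hc, ht⟩ := hms
  -- eventually `Z_m(k) ≥ c/2`
  have hZ : ∀ᶠ k in atTop, c / 2 ≤ reg.Zm k := by
    have h1 : ∀ᶠ k in atTop, c / 2 ≤ reg.Zm k / Real.log (1 / reg.a k ^ 2) ^ massExponent Nf :=
      ht.eventually (eventually_ge_nhds (by linarith))
    have h2 : ∀ᶠ k in atTop, 1 ≤ Real.log (1 / reg.a k ^ 2) := (tendsto_log_inv_sq reg).eventually_ge_atTop 1
    filter_upwards [h1, h2] with k hk1 hk2
    have hpow : 1 ≤ Real.log (1 / reg.a k ^ 2) ^ massExponent Nf := Real.one_le_rpow hk2 hγ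
    have hpos : 0 < Real.log (1 / reg.a k ^ 2) ^ massExponent Nf := by positivity
    rw [le_div_iff₀ hpos] at hk1
    nlinarith [hc]
  -- eventually `a_k |M| ≤ ε c / 2`
  have hA : ∀ᶠ k in atTop, reg.a k * |M| ≤ ε * (c / 2) := by
    have ht0 : Tendsto (fun k => reg.a k * |M|) atTop (𝓝 (0 * |M|)) := reg.tendsto_a.mul_const _
    rw [zero_mul] at ht0
    exact ht0.eventually (eventually_le_nhds (by positivity))
  filter_upwards [hZ, hA] with k hkZ hkA
  have hZpos : 0 < reg.Zm k := reg.Zm_pos k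
  rw [div_le_iff₀ hZpos]
  calc reg.a k * M ≤ reg.a k * |M| := mul_le_mul_of_nonneg_left (le_abs_self M) (reg.a_pos k).le
    _ ≤ ε * (c / 2) := hkA
    _ ≤ ε * reg.Zm k := mul_le_mul_of_nonneg_left hkZ hε.le

/-- `γ₀/(2β₀) > 0` for `N_f ≤ 16` (asymptotic freedom), in particular for `N_f ∈ {2, 3}`. [folklore] -/
theorem massExponent_pos (hNf : (Nf : ℝ) ≤ 16) : 0 < massExponent Nf := by
  have hπ : 0 < Real.pi ^ 2 := by positivity
  have hb : 0 < betaCoeff₀ Nf := by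
    unfold betaCoeff₀
    exact div_pos (by linarith) (by positivity)
  unfold massExponent gammaCoeff₀
  exact div_pos (by positivity) (by positivity)

/-! ### The lattice-light witness of the crux minus clause (iii) -/

/-- **The crux minus clause (iii) has a LATTICE-LIGHT witness.**  For `N_f ∈ {2,3}` the regularisation
`canonicalAF` with the critical mass parked at `m_crit(k) := a_k` — so that every realised bare mass lies
in `[a_k, 2a_k]` eventually (`κ → 1/8` from below, lattice-light) — has leading-log mass scaling and
two-loop asymptotic scaling, and for EVERY positive mass tuple satisfies clause (i), clause (ii) UPPER at
a physical-form rate `δ a_k` with a `k`-uniform constant (deterministically), and clause (iv) SIGN with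
ratio `1`.  Together with `heavyReg` (disproof §3) this shows that nothing in the crux but clause (iii)
distinguishes an honest Wilson trajectory (`m_crit(k) ≈ m_c(β_k) < 0`) from junk. [folklore] -/
theorem exists_light_witness_without_lower :
    ∀ Nf : ℕ, Nf = 2 ∨ Nf = 3 → ∃ reg : QCDRegularisation Nf,
      reg.HasMassScaling ∧ (reg.scheme 0 0 0).HasAsymptoticScaling ∧ (∀ k, reg.mcrit k = reg.a k) ∧
        ∀ m : Fin Nf → ℝ, (∀ f, 0 < m f) →
          (∀ᶠ k in atTop, ∀ f, reg.a k ≤ bare reg m k f ∧ bare reg m k f ≤ 2 * reg.a k) ∧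
            ClauseI reg m ∧ Upper reg m ∧ Sign reg m := by
  intro Nf hNf
  have hγ : 0 < massExponent Nf := massExponent_pos (by rcases hNf with rfl | rfl <;> norm_num)
  refine ⟨{ QCDRegularisation.canonicalAF Nf with mcrit := (QCDRegularisation.canonicalAF Nf).a },
    QCDRegularisation.canonicalAF_hasMassScaling, ?_, fun _ => rfl, ?_⟩
  · refine ⟨1, one_pos, tendsto_const_nhds.congr' (Eventually.of_forall fun k => ?_)⟩
    show (0 : ℝ) = afBeta Nf 1 ((SpeciesScheme.zero Unit).a k) - afBeta Nf 1 ((SpeciesScheme.zero Unit).a k)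
    rw [sub_self]
  · intro m hm
    set reg : QCDRegularisation Nf :=
      { QCDRegularisation.canonicalAF Nf with mcrit := (QCDRegularisation.canonicalAF Nf).a } with hreg
    have hmc : ∀ k, reg.mcrit k = reg.a k := fun _ => rfl
    -- the window `[a_k, 2a_k]`, eventually
    set M : ℝ := (∑ f, m f) + 1 with hMdef
    have hmM : ∀ f, m f ≤ M := fun f =>
      (Finset.single_le_sum (fun g _ => (hm g).le) (Finset.mem_univ f)).trans (le_add_of_nonneg_right zero_le_one)
    have hwin : ∀ᶠ k in atTop, ∀ f, reg.a k ≤ bare reg m k f ∧ bare reg m k f ≤ 2 * reg.a k := by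
      have h1 := eventually_a_mul_div_Zm_le reg QCDRegularisation.canonicalAF_hasMassScaling hγ.le M 1 one_pos
      -- we need `a_k m_f / Z_m(k) ≤ a_k`, i.e. `m_f ≤ Z_m(k)`: use `Z_m → ∞` in the form `a M/Z ≤ a`?
      -- simpler: `Z_m(k) ≥ M` eventually, from `Z_m(k)/log^γ → 1` and `log^γ → ∞`
      have hZ : ∀ᶠ k in atTop, M ≤ reg.Zm k := by
        obtain ⟨c, hc, ht⟩ := (QCDRegularisation.canonicalAF_hasMassScaling : reg.HasMassScaling)
        have hl : Tendsto (fun k => Real.log (1 / reg.a k ^ 2) ^ massExponent Nf) atTop atTop :=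
          (tendsto_rpow_atTop hγ).comp (tendsto_log_inv_sq reg)
        have h2 : ∀ᶠ k in atTop, c / 2 ≤ reg.Zm k / Real.log (1 / reg.a k ^ 2) ^ massExponent Nf :=
          ht.eventually (eventually_ge_nhds (by linarith))
        have h3 : ∀ᶠ k in atTop, 2 * |M| / c ≤ Real.log (1 / reg.a k ^ 2) ^ massExponent Nf :=
          hl.eventually_ge_atTop _
        have h4 : ∀ᶠ k in atTop, 1 ≤ Real.log (1 / reg.a k ^ 2) := (tendsto_log_inv_sq reg).eventually_ge_atTop 1
        filter_upwards [h2, h3, h4] with k hk2 hk3 hk4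
        have hpos : 0 < Real.log (1 / reg.a k ^ 2) ^ massExponent Nf := by positivity
        rw [le_div_iff₀ hpos] at hk2
        rw [div_le_iff₀ hc] at hk3
        calc M ≤ |M| := le_abs_self M
          _ = (2 * |M| / c) * (c / 2) := by field_simp
          _ ≤ (2 * |M| / c) * (c / 2) := le_rfl
          _ ≤ Real.log (1 / reg.a k ^ 2) ^ massExponent Nf * (c / 2) := by
              apply mul_le_mul_of_nonneg_right _ (by linarith)
              rw [div_le_iff₀ hc]; linarith
          _ = c / 2 * Real.log (1 / reg.a k ^ 2) ^ massExponent Nf := mul_comm _ _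
          _ ≤ reg.Zm k := hk2
      filter_upwards [hZ] with k hk f
      have ha := reg.a_pos k
      have hZpos := reg.Zm_pos k
      have hq : 0 ≤ reg.a k * m f / reg.Zm k := div_nonneg (mul_nonneg ha.le (hm f).le) hZpos.le
      have hq' : reg.a k * m f / reg.Zm k ≤ reg.a k := by
        rw [div_le_iff₀ hZpos]
        exact mul_le_mul_of_nonneg_left ((hmM f).trans hk) ha.le
      simp only [bare, hmc]
      constructor <;> linarith
    have hposk : ∀ᶠ k in atTop, ∀ f, 0 < bare reg m k f :=
      hwin.mono fun k hk f => lt_of_lt_of_le (reg.a_pos k) (hk f).1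
    refine ⟨hwin, clauseI_of_eventually_pos reg m hposk, ?_, sign_of_eventually_pos reg m hposk⟩
    refine upper_of_eventually_pos_light reg m ⟨1, one_pos, ?_⟩
    have ha1 : ∀ᶠ k in atTop, 2 * reg.a k ≤ 1 := by
      have := reg.tendsto_a.eventually (eventually_le_nhds (show (0 : ℝ) < 1 / 2 by norm_num))
      exact this.mono fun k hk => by linarith
    filter_upwards [hwin, ha1] with k hk hk1 f
    exact ⟨by linarith [(hk f).1], (hk f).2.trans hk1⟩

/-! ### The crux from clause (iii) along a positive trajectory -/

/-- **`MobilityGap` from clause (iii) alone, along positive lattice-light critical masses.**  If for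
`N_f ∈ {2,3}` some regularisation with both scalings keeps its critical mass in `[c a_k, 1/2]`
eventually (`c > 0`) and satisfies clause (iii) LOWER for every positive mass tuple, then `MobilityGap`
holds: (i) and (iv) are free at positive bare masses, and (ii) is the deterministic bound above.
PHYSICS CAVEAT: the hypothesis is expected to be false (additive mass renormalisation `m_c(β) < 0`
makes such quarks lattice-massive at rate `≍ 1/β_k ≫ a_k`); the theorem maps where the content of the
crux sits — clause (iii) — it is not a proof strategy. [folklore] -/
theorem mobilityGap_of_posLower
    (h : ∀ Nf : ℕ, Nf = 2 ∨ Nf = 3 → ∃ reg : QCDRegularisation Nf,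
      reg.HasMassScaling ∧ (reg.scheme 0 0 0).HasAsymptoticScaling ∧
        (∃ c : ℝ, 0 < c ∧ ∀ᶠ k in atTop, c * reg.a k ≤ reg.mcrit k ∧ reg.mcrit k ≤ 1 / 2) ∧
          ∀ m : Fin Nf → ℝ, (∀ f, 0 < m f) → Lower reg m) :
    Summit.QuantumFields.QCD.Theses.WilsonMobilityGap.MobilityGap := by
  rw [mobilityGap_iff]
  intro Nf hNf
  obtain ⟨reg, hms, has, ⟨c, hc, hk⟩, hlow⟩ := h Nf hNf
  have hγ : 0 < massExponent Nf := massExponent_pos (by rcases hNf with rfl | rfl <;> norm_num)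
  refine ⟨reg, hms, has, fun m hm => ?_⟩
  set M : ℝ := (∑ f, m f) + 1 with hMdef
  have hmM : ∀ f, m f ≤ M := fun f =>
    (Finset.single_le_sum (fun g _ => (hm g).le) (Finset.mem_univ f)).trans (le_add_of_nonneg_right zero_le_one)
  have hsmall := eventually_a_mul_div_Zm_le reg hms hγ.le M (1 / 2) (by norm_num)
  have hwin : ∀ᶠ k in atTop, ∀ f, c * reg.a k ≤ bare reg m k f ∧ bare reg m k f ≤ 1 := by
    filter_upwards [hk, hsmall] with k hk hks f
    have ha := reg.a_pos k
    have hZ := reg.Zm_pos k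
    have hq : 0 ≤ reg.a k * m f / reg.Zm k := div_nonneg (mul_nonneg ha.le (hm f).le) hZ.le
    have hq' : reg.a k * m f / reg.Zm k ≤ 1 / 2 := by
      refine le_trans ?_ hks
      exact div_le_div_of_nonneg_right (mul_le_mul_of_nonneg_left (hmM f) ha.le) hZ.le
    simp only [bare]
    constructor <;> linarith [hk.1, hk.2]
  have hposk : ∀ᶠ k in atTop, ∀ f, 0 < bare reg m k f :=
    hwin.mono fun k hk f => lt_of_lt_of_le (mul_pos hc (reg.a_pos k)) (hk f).1
  exact ⟨clauseI_of_eventually_pos reg m hposk, upper_of_eventually_pos_light reg m ⟨c, hc, hwin⟩,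
    hlow m hm, sign_of_eventually_pos reg m hposk⟩

end Summit.QuantumFields.QCD.Theorems.MobilityGapPositiveMass

end
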